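import Literature.NumberTheory.EllipticCurves.BipartiteToricPeriod
import Literature.NumberTheory.EllipticCurves.SelmerCorankHolds
import HarnessLib

/-!
# The TORIC door: a non-zero toric period of a level-raised definite eigenform at depth
# `ν(n) ≤ rank E(ℚ) + rank E^{(d_K)}(ℚ)` certifies `corank Ш(E)[p^∞] = corank Ш(E^{(d_K)})[p^∞] = 0`
# (modulo C.-H. Kim 2024, Thm. 4.26) — the "rank-0 companion `L`-value" form of the depth door

Route-INDEPENDENT helper (no `Theses` import), written for route `KolyvaginDepthDoor`, crux
`KolyvaginDepthSupply` (stmt-BirchSwinnertonDyer-21765), landed `--supports` that item; it closes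
nothing and BSD is not proved by it.

The route header's TWO-LAYER PLAN puts under the rank-2 slice a "`LevelRaisedUnitSupply` (∃
admissible `(ℓ, ℓ′)` with the Gross period of the level-`Nℓℓ′` definite eigenform a `p`-unit) — the
rank-0 companion `L`-value form of the door", via Bertolini–Darmon 2005 / W. Zhang 2014 §4. In the
tree that mechanism is ALREADY a named fact, in the bipartite-Euler-system form of C.-H. Kim, *A
higher Gross–Zagier formula and the structure of Selmer groups*, TAMS 377 (2024), Thm. 4.26 (held
arXiv v3: Thm. 5.23): `Literature.NumberTheory.EllipticCurves.kim_selmerCorank_baseChange_le_of_toricPeriod_ne_zero`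
(a non-zero mod-`p^M` toric period `λ^bip_n` of the level-raised quaternionic eigenform on the
definite algebra `B_{N⁻n}`, `n` a square-free product of `2M`-admissible primes, bounds
`corank_{ℤ_p} Sel_{p^∞}(E/K) ≤ ν(n)`), consumed by route `ToricShedding` (crux `BipartiteToricBound`,
stmt-BirchSwinnertonDyer-16085) in the ANALYTIC direction (`ν(n) = ord L(E) + ord L(E^{(d_K)})`).
Read "points first" it is a second per-curve door for X1, with a CHEAPER instrument than derived
Heegner points over ring class fields (Brandt-module linear algebra at level `N⁺`, discriminant
`N⁻n`):

* `shaCorank_eq_zero_of_toricPeriod_ne_zero_of_depth_le_rank_add` — **the toric door.** In the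
  setting of Kim's theorem (binders VERBATIM those of the tree fact / of route item
  `BipartiteToricBound`), if the toric period is non-zero and
  `ν(n) ≤ rank E(ℚ) + rank E^{(d_K)}(ℚ)`, then `corank_{ℤ_p} Ш(E/ℚ)[p^∞] = 0`,
  `corank_{ℤ_p} Ш(E^{(d_K)}/ℚ)[p^∞] = 0`, `corank Sel_{p^∞}(E/ℚ) = rank E(ℚ)`,
  `corank Sel_{p^∞}(E^{(d_K)}/ℚ) = rank E^{(d_K)}(ℚ)` and `ν(n) = rank E(ℚ) + rank E^{(d_K)}(ℚ)`
  (Kim's bound `c + c' ≤ ν(n)` — `selmerCorank_add_twist_le_of_toricPeriod_ne_zero`, the fact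
  composed with the PROVED `corank Sel(E/K) = c + c'` — against Kummer's `c ≥ r`, `c' ≥ r'`).
* `shaCorank_eq_zero_and_rank_eq_two_of_toricPeriod_ne_zero` — the rank-2 row: `2 ≤ rank E(ℚ)`
  (a kernel certificate, e.g. the tree's `Rank2Observatory` witnesses) and a non-zero period at TWO
  admissible primes (`ν(n) = 2`) give `t_p(E) = 0`, `rank E(ℚ) = 2` EXACTLY, `c = 2`, and
  `c' = rank E^{(d_K)}(ℚ) = 0`.

Notation: `c = W.selmerCorank p`, `c' = (W.quadraticTwist d_K).selmerCorank p`, `r, r'` the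
Mordell–Weil ranks, `t_p = c − r` (`selmerCorank_eq_mordellWeilRank_add_holds`, Greenberg LNM 1716
§1, proved in the tree). Honesty: the computed bit (the period is `≠ 0`) is a HYPOTHESIS — the
instrument's output; Kim's theorem is a named fact (XL); per-curve, not a class theorem.

References: [Kim2024] C.-H. Kim, TAMS 377 (2024) = arXiv:2203.12161, Thm. 4.26 (v3: 5.23);
[BertoliniDarmon2005] Ann. of Math. 162; [WZhang2014] Camb. J. Math. 2, §4; [GreenbergLNM1716] §1.
-/

set_option linter.dupNamespace false

noncomputable section

open scoped Classical BigOperators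

namespace Summit.BirchSwinnertonDyer.BirchSwinnertonDyer.Theorems.KolyvaginDepthDoor

open Literature.NumberTheory.EllipticCurves WeierstrassCurve

/-- **The toric door (modulo Kim 2024, Thm. 4.26).** Binders verbatim those of
`kim_selmerCorank_baseChange_le_of_toricPeriod_ne_zero` / route item `BipartiteToricBound`
(`W` globally minimal; `p ≥ 5` good ordinary, `ρ̄_{E,p}` onto, `p ∤ q² − 1` for `q ∣ N`; `K`
imaginary quadratic, `d_K < −4`, `(d_K, Np) = 1`; `N = N⁺N⁻` with `N⁺`-primes split, `N⁻n`-primes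
inert, `N⁻` square-free with an odd number of primes; `n` square-free prime to `Npd_K` with every
`ℓ ∣ n` `2M`-admissible; `B = (a, b)_ℚ` definite ramified exactly at `N⁻n`; `O` Eichler of level
`N⁺`; `RI`, `IsEig`, the primitive eigenfunction `φ` alone on its line; a conductor-`1` Gross point
`(ψ, I, rep)`). If the toric period `Σ_{[𝔞]} φ(ψ(rep 𝔞)·I) ≠ 0` in `ℤ/p^M` and
`ν(n) ≤ rank E(ℚ) + rank E^{(d_K)}(ℚ)` ("depth at most the number of known independent points on
`E` and its twist"), then `corank_{ℤ_p} Ш(E/ℚ)[p^∞] = 0`, `corank_{ℤ_p} Ш(E^{(d_K)}/ℚ)[p^∞] = 0`,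
`corank Sel_{p^∞}(E/ℚ) = rank E(ℚ)`, `corank Sel_{p^∞}(E^{(d_K)}/ℚ) = rank E^{(d_K)}(ℚ)`,
`ν(n) = rank E(ℚ) + rank E^{(d_K)}(ℚ)`: Kim's `c + c' ≤ ν(n)` against Kummer's `c = r + t_p`,
`c' = r' + t'_p`. CONDITIONAL on the fact `h` and on the computed bit; per-curve; BSD is not proved
by it. [cite: Kim2024, Thm 5.23 (arXiv v3) = Thm 4.26 (published, arXiv:2203.12161v7)]
[cite: GreenbergLNM1716, §1 pp. 54–57] -/
theorem shaCorank_eq_zero_of_toricPeriod_ne_zero_of_depth_le_rank_add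
    (h : kim_selmerCorank_baseChange_le_of_toricPeriod_ne_zero) :
    ∀ (W : WeierstrassCurve ℚ) [W.IsElliptic] [W.IsGloballyMinimal] (p : ℕ) [Fact p.Prime] (M Nplus
      Nminus n : ℕ) (a b : ℚ) (O : Subring (QuaternionAlgebra ℚ a 0 b)) (K : Type) [Field K]
      [NumberField K] (ψ : K →ₐ[ℚ] QuaternionAlgebra ℚ a 0 b) (I : Submodule ℤ (QuaternionAlgebra ℚ
      a 0 b)) (φ : Submodule ℤ (QuaternionAlgebra ℚ a 0 b) → ZMod (p ^ M)) (rep : ClassGroup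
      (NumberField.RingOfIntegers K) → nonZeroDivisors (Ideal (NumberField.RingOfIntegers K))) (RI :
      Set (Submodule ℤ (QuaternionAlgebra ℚ a 0 b))) (IsEig : (Submodule ℤ (QuaternionAlgebra ℚ a 0
      b) → ZMod (p ^ M)) → Prop), ((5 ≤ p ∧ 1 ≤ M ∧ W.HasGoodReductionAtPrime p ∧ ¬ (p : ℤ) ∣
      W.frobeniusTrace p ∧ W.HasSurjectiveModNGaloisRep p ∧ (∀ q : ℕ, q.Prime → q ∣ W.conductorNorm
      ℤ → ¬ (p : ℤ) ∣ (q : ℤ) ^ 2 - 1)) ∧ (Module.finrank ℚ K = 2 ∧ NumberField.IsTotallyComplex K ∧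
      NumberField.discr K < -4 ∧ Int.gcd (NumberField.discr K) (W.conductorNorm ℤ * p) = 1) ∧
      (W.conductorNorm ℤ = Nplus * Nminus ∧ Nat.Coprime Nplus Nminus ∧ Squarefree Nminus ∧ Odd
      Nminus.primeFactors.card ∧ (∀ q : ℕ, q.Prime → q ∣ Nplus → ((Ideal.span {(q : ℤ)}).primesOver
      (NumberField.RingOfIntegers K)).ncard = 2) ∧ (∀ q : ℕ, q.Prime → q ∣ Nminus * n → ((Ideal.span
      {(q : ℤ)}).primesOver (NumberField.RingOfIntegers K)).ncard = 1)) ∧ (Squarefree n ∧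
      Nat.Coprime n (W.conductorNorm ℤ * p) ∧ Int.gcd (NumberField.discr K) n = 1 ∧ (∀ ℓ : ℕ,
      ℓ.Prime → ℓ ∣ n → ¬ (p : ℤ) ∣ (ℓ : ℤ) ^ 2 - 1 ∧ ((p : ℤ) ^ (2 * M) ∣ W.frobeniusTrace ℓ - (ℓ +
      1) ∨ (p : ℤ) ^ (2 * M) ∣ W.frobeniusTrace ℓ + (ℓ + 1)))) ∧ (a < 0 ∧ b < 0 ∧ (∀ (q : ℕ) [Fact
      q.Prime], (∀ x : QuaternionAlgebra ℚ_[q] (a : ℚ_[q]) 0 (b : ℚ_[q]), x ≠ 0 → IsUnit x) ↔ q ∣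
      Nminus * n)) ∧ (∃ O₁ O₂ : Subring (QuaternionAlgebra ℚ a 0 b), (∀ S : Subring
      (QuaternionAlgebra ℚ a 0 b), (S = O₁ ∨ S = O₂) → (S.toAddSubgroup.FG ∧ (∀ d :
      QuaternionAlgebra ℚ a 0 b, ∃ m : ℤ, m ≠ 0 ∧ m • d ∈ S) ∧ ∀ S' : Subring (QuaternionAlgebra ℚ a
      0 b), S'.toAddSubgroup.FG → S ≤ S' → S' = S)) ∧ O = O₁ ⊓ O₂ ∧ O.toAddSubgroup.relIndex
      O₁.toAddSubgroup = Nplus) ∧ ((∀ J : Submodule ℤ (QuaternionAlgebra ℚ a 0 b), J ∈ RI ↔ (J.FG ∧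
      (∀ d : QuaternionAlgebra ℚ a 0 b, ∃ m : ℤ, m ≠ 0 ∧ m • d ∈ J) ∧ (∀ x : QuaternionAlgebra ℚ a 0
      b, (∀ y ∈ J, y * x ∈ J) ↔ x ∈ O) ∧ (∃ J' : Submodule ℤ (QuaternionAlgebra ℚ a 0 b), (∀ x :
      QuaternionAlgebra ℚ a 0 b, x ∈ J * J' ↔ ∀ y ∈ J, x * y ∈ J) ∧ (∀ x : QuaternionAlgebra ℚ a 0
      b, x ∈ J' * J ↔ x ∈ O)))) ∧ (∀ g : Submodule ℤ (QuaternionAlgebra ℚ a 0 b) → ZMod (p ^ M),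
      IsEig g ↔ ((∀ J ∈ RI, ∀ β : QuaternionAlgebra ℚ a 0 b, IsUnit β → g (J.map
      (AddMonoidHom.mulLeft β).toIntLinearMap) = g J) ∧ (∀ q : ℕ, q.Prime → ¬ q ∣ W.conductorNorm ℤ
      * n → ∀ J ∈ RI, ∑ᶠ J' ∈ {J' : Submodule ℤ (QuaternionAlgebra ℚ a 0 b) | J' ≤ J ∧
      J'.toAddSubgroup.relIndex J.toAddSubgroup = q ^ 2 ∧ ∀ y ∈ J', ∀ x ∈ O, y * x ∈ J'}, g J' =
      ((W.frobeniusTrace q : ℤ) : ZMod (p ^ M)) * g J))) ∧ IsEig φ ∧ (∃ J ∈ RI, IsUnit (φ J)) ∧ (∀ g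
      : Submodule ℤ (QuaternionAlgebra ℚ a 0 b) → ZMod (p ^ M), IsEig g → ∃ u : ZMod (p ^ M), ∀ J ∈
      RI, g J = u * φ J)) ∧ (I ∈ RI ∧ (∀ x : NumberField.RingOfIntegers K, ∀ y ∈ I, ψ (x : K) * y ∈
      I) ∧ (∀ x : K, (∀ y ∈ I, ψ x * y ∈ I) → ∃ z : NumberField.RingOfIntegers K, (z : K) = x) ∧ (∀
      𝔞 : ClassGroup (NumberField.RingOfIntegers K), ClassGroup.mk0 (rep 𝔞) = 𝔞))) → (∑ 𝔞 :
      ClassGroup (NumberField.RingOfIntegers K), φ (Submodule.span ℤ ((fun x :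
      NumberField.RingOfIntegers K => ψ (x : K)) '' ((rep 𝔞 : nonZeroDivisors (Ideal
      (NumberField.RingOfIntegers K))) : Ideal (NumberField.RingOfIntegers K))) * I)) ≠ 0 →
      n.primeFactors.card ≤ W.mordellWeilRank +
          (W.quadraticTwist (NumberField.discr K : ℚ)).mordellWeilRank →
      W.shaCorank p = 0 ∧ (W.quadraticTwist (NumberField.discr K : ℚ)).shaCorank p = 0 ∧
        W.selmerCorank p = W.mordellWeilRank ∧
        (W.quadraticTwist (NumberField.discr K : ℚ)).selmerCorank p =
          (W.quadraticTwist (NumberField.discr K : ℚ)).mordellWeilRank ∧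
        n.primeFactors.card = W.mordellWeilRank +
          (W.quadraticTwist (NumberField.discr K : ℚ)).mordellWeilRank := by
  intro W _ _ p _ M Nplus Nminus n a b O K _ _ ψ I φ rep RI IsEig hyp hper hdepth
  have hle := selmerCorank_add_twist_le_of_toricPeriod_ne_zero h W p M Nplus Nminus n a b O K ψ I φ
    rep RI IsEig hyp hper
  have hid : W.selmerCorank p = W.mordellWeilRank + W.shaCorank p :=
    W.selmerCorank_eq_mordellWeilRank_add_holds p
  have hd4 : NumberField.discr K < -4 := hyp.2.1.2.2.1
  have hdK : (NumberField.discr K : ℚ) ≠ 0 := by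
    have : NumberField.discr K ≠ 0 := by omega
    exact_mod_cast this
  haveI := W.isElliptic_quadraticTwist hdK
  have hidT : (W.quadraticTwist (NumberField.discr K : ℚ)).selmerCorank p =
      (W.quadraticTwist (NumberField.discr K : ℚ)).mordellWeilRank +
        (W.quadraticTwist (NumberField.discr K : ℚ)).shaCorank p :=
    (W.quadraticTwist (NumberField.discr K : ℚ)).selmerCorank_eq_mordellWeilRank_add_holds p
  omega

/-- **The rank-2 row of the toric door (modulo Kim 2024, Thm. 4.26).** Same binders; if
`2 ≤ rank E(ℚ)` (e.g. a kernel certificate of two independent points) and the toric period at a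
square-free product `n` of TWO `2M`-admissible primes (`ν(n) = 2`) is non-zero, then
`corank_{ℤ_p} Ш(E/ℚ)[p^∞] = 0`, `rank E(ℚ) = 2` EXACTLY, `corank Sel_{p^∞}(E/ℚ) = 2`, and the
twist has `corank Sel_{p^∞}(E^{(d_K)}/ℚ) = rank E^{(d_K)}(ℚ) = 0`. This is the route's
"`LevelRaisedUnitSupply ⇒` rank-2 door" with the level-raised period as the instrument bit.
CONDITIONAL on `h` and on the computed bit; per-curve; BSD is not proved by it.
[cite: Kim2024, Thm 5.23 (arXiv v3) = Thm 4.26 (published, arXiv:2203.12161v7)]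
[cite: GreenbergLNM1716, §1 pp. 54–57] -/
theorem shaCorank_eq_zero_and_rank_eq_two_of_toricPeriod_ne_zero
    (h : kim_selmerCorank_baseChange_le_of_toricPeriod_ne_zero) :
    ∀ (W : WeierstrassCurve ℚ) [W.IsElliptic] [W.IsGloballyMinimal] (p : ℕ) [Fact p.Prime] (M Nplus
      Nminus n : ℕ) (a b : ℚ) (O : Subring (QuaternionAlgebra ℚ a 0 b)) (K : Type) [Field K]
      [NumberField K] (ψ : K →ₐ[ℚ] QuaternionAlgebra ℚ a 0 b) (I : Submodule ℤ (QuaternionAlgebra ℚ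
      a 0 b)) (φ : Submodule ℤ (QuaternionAlgebra ℚ a 0 b) → ZMod (p ^ M)) (rep : ClassGroup
      (NumberField.RingOfIntegers K) → nonZeroDivisors (Ideal (NumberField.RingOfIntegers K))) (RI :
      Set (Submodule ℤ (QuaternionAlgebra ℚ a 0 b))) (IsEig : (Submodule ℤ (QuaternionAlgebra ℚ a 0
      b) → ZMod (p ^ M)) → Prop), ((5 ≤ p ∧ 1 ≤ M ∧ W.HasGoodReductionAtPrime p ∧ ¬ (p : ℤ) ∣
      W.frobeniusTrace p ∧ W.HasSurjectiveModNGaloisRep p ∧ (∀ q : ℕ, q.Prime → q ∣ W.conductorNorm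
      ℤ → ¬ (p : ℤ) ∣ (q : ℤ) ^ 2 - 1)) ∧ (Module.finrank ℚ K = 2 ∧ NumberField.IsTotallyComplex K ∧
      NumberField.discr K < -4 ∧ Int.gcd (NumberField.discr K) (W.conductorNorm ℤ * p) = 1) ∧
      (W.conductorNorm ℤ = Nplus * Nminus ∧ Nat.Coprime Nplus Nminus ∧ Squarefree Nminus ∧ Odd
      Nminus.primeFactors.card ∧ (∀ q : ℕ, q.Prime → q ∣ Nplus → ((Ideal.span {(q : ℤ)}).primesOver
      (NumberField.RingOfIntegers K)).ncard = 2) ∧ (∀ q : ℕ, q.Prime → q ∣ Nminus * n → ((Ideal.span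
      {(q : ℤ)}).primesOver (NumberField.RingOfIntegers K)).ncard = 1)) ∧ (Squarefree n ∧
      Nat.Coprime n (W.conductorNorm ℤ * p) ∧ Int.gcd (NumberField.discr K) n = 1 ∧ (∀ ℓ : ℕ,
      ℓ.Prime → ℓ ∣ n → ¬ (p : ℤ) ∣ (ℓ : ℤ) ^ 2 - 1 ∧ ((p : ℤ) ^ (2 * M) ∣ W.frobeniusTrace ℓ - (ℓ +
      1) ∨ (p : ℤ) ^ (2 * M) ∣ W.frobeniusTrace ℓ + (ℓ + 1)))) ∧ (a < 0 ∧ b < 0 ∧ (∀ (q : ℕ) [Fact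
      q.Prime], (∀ x : QuaternionAlgebra ℚ_[q] (a : ℚ_[q]) 0 (b : ℚ_[q]), x ≠ 0 → IsUnit x) ↔ q ∣
      Nminus * n)) ∧ (∃ O₁ O₂ : Subring (QuaternionAlgebra ℚ a 0 b), (∀ S : Subring
      (QuaternionAlgebra ℚ a 0 b), (S = O₁ ∨ S = O₂) → (S.toAddSubgroup.FG ∧ (∀ d :
      QuaternionAlgebra ℚ a 0 b, ∃ m : ℤ, m ≠ 0 ∧ m • d ∈ S) ∧ ∀ S' : Subring (QuaternionAlgebra ℚ a
      0 b), S'.toAddSubgroup.FG → S ≤ S' → S' = S)) ∧ O = O₁ ⊓ O₂ ∧ O.toAddSubgroup.relIndex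
      O₁.toAddSubgroup = Nplus) ∧ ((∀ J : Submodule ℤ (QuaternionAlgebra ℚ a 0 b), J ∈ RI ↔ (J.FG ∧
      (∀ d : QuaternionAlgebra ℚ a 0 b, ∃ m : ℤ, m ≠ 0 ∧ m • d ∈ J) ∧ (∀ x : QuaternionAlgebra ℚ a 0
      b, (∀ y ∈ J, y * x ∈ J) ↔ x ∈ O) ∧ (∃ J' : Submodule ℤ (QuaternionAlgebra ℚ a 0 b), (∀ x :
      QuaternionAlgebra ℚ a 0 b, x ∈ J * J' ↔ ∀ y ∈ J, x * y ∈ J) ∧ (∀ x : QuaternionAlgebra ℚ a 0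
      b, x ∈ J' * J ↔ x ∈ O)))) ∧ (∀ g : Submodule ℤ (QuaternionAlgebra ℚ a 0 b) → ZMod (p ^ M),
      IsEig g ↔ ((∀ J ∈ RI, ∀ β : QuaternionAlgebra ℚ a 0 b, IsUnit β → g (J.map
      (AddMonoidHom.mulLeft β).toIntLinearMap) = g J) ∧ (∀ q : ℕ, q.Prime → ¬ q ∣ W.conductorNorm ℤ
      * n → ∀ J ∈ RI, ∑ᶠ J' ∈ {J' : Submodule ℤ (QuaternionAlgebra ℚ a 0 b) | J' ≤ J ∧
      J'.toAddSubgroup.relIndex J.toAddSubgroup = q ^ 2 ∧ ∀ y ∈ J', ∀ x ∈ O, y * x ∈ J'}, g J' =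
      ((W.frobeniusTrace q : ℤ) : ZMod (p ^ M)) * g J))) ∧ IsEig φ ∧ (∃ J ∈ RI, IsUnit (φ J)) ∧ (∀ g
      : Submodule ℤ (QuaternionAlgebra ℚ a 0 b) → ZMod (p ^ M), IsEig g → ∃ u : ZMod (p ^ M), ∀ J ∈
      RI, g J = u * φ J)) ∧ (I ∈ RI ∧ (∀ x : NumberField.RingOfIntegers K, ∀ y ∈ I, ψ (x : K) * y ∈
      I) ∧ (∀ x : K, (∀ y ∈ I, ψ x * y ∈ I) → ∃ z : NumberField.RingOfIntegers K, (z : K) = x) ∧ (∀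
      𝔞 : ClassGroup (NumberField.RingOfIntegers K), ClassGroup.mk0 (rep 𝔞) = 𝔞))) → (∑ 𝔞 :
      ClassGroup (NumberField.RingOfIntegers K), φ (Submodule.span ℤ ((fun x :
      NumberField.RingOfIntegers K => ψ (x : K)) '' ((rep 𝔞 : nonZeroDivisors (Ideal
      (NumberField.RingOfIntegers K))) : Ideal (NumberField.RingOfIntegers K))) * I)) ≠ 0 →
      2 ≤ W.mordellWeilRank → n.primeFactors.card = 2 →
      W.shaCorank p = 0 ∧ W.mordellWeilRank = 2 ∧ W.selmerCorank p = 2 ∧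
        (W.quadraticTwist (NumberField.discr K : ℚ)).selmerCorank p = 0 ∧
        (W.quadraticTwist (NumberField.discr K : ℚ)).mordellWeilRank = 0 := by
  intro W _ _ p _ M Nplus Nminus n a b O K _ _ ψ I φ rep RI IsEig hyp hper h2 hν
  have hle := selmerCorank_add_twist_le_of_toricPeriod_ne_zero h W p M Nplus Nminus n a b O K ψ I φ
    rep RI IsEig hyp hper
  have hid : W.selmerCorank p = W.mordellWeilRank + W.shaCorank p :=
    W.selmerCorank_eq_mordellWeilRank_add_holds p
  have hd4 : NumberField.discr K < -4 := hyp.2.1.2.2.1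
  have hdK : (NumberField.discr K : ℚ) ≠ 0 := by
    have : NumberField.discr K ≠ 0 := by omega
    exact_mod_cast this
  haveI := W.isElliptic_quadraticTwist hdK
  have hidT : (W.quadraticTwist (NumberField.discr K : ℚ)).selmerCorank p =
      (W.quadraticTwist (NumberField.discr K : ℚ)).mordellWeilRank +
        (W.quadraticTwist (NumberField.discr K : ℚ)).shaCorank p :=
    (W.quadraticTwist (NumberField.discr K : ℚ)).selmerCorank_eq_mordellWeilRank_add_holds p
  omega

end Summit.BirchSwinnertonDyer.BirchSwinnertonDyer.Theorems.KolyvaginDepthDoor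

end
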